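import Literature.AnabelianGeometry.AbsoluteAnabelian.GeneralizedSubpadicSlimProofs
import HarnessLib

/-!
# Units of generalized sub-`p`-adic fields: a `p`-adic order and "infinitely divisible ⟹ torsion"

Two by-products of the proof of [Tpcs] Lemma 4.14 (`GeneralizedSubpadicSlimProofs.lean`), exported
for direct use over generalized sub-`p`-adic base fields ([Tpcs] Def 4.11 p. 44: subfields of
finitely generated extensions of `Frac W(𝔽̄_p)`; [AbsTopIII] Rmk 1.5.4 (iv) p. 34 recalls them and
notes that they "are not, in general, torally Kummer-faithful" — the Teichmüller roots of unity are
infinitely divisible):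

* `AbsTopIII.IsGeneralizedSubpadicFor.exists_unitsHom_apply_natCast_ne_one`: a homomorphism `K^× → ℤ` that
  does not vanish at `p` (Gauss `p`-order and norm, `GaussOrderDVR.lean`);
* `AbsTopIII.IsGeneralizedSubpadicFor.isOfFinOrder_of_forall_exists_pow_eq`: the POSITIVE complement of
  Rmk 1.5.4 (iv) — an element of `K^×` which is an `N`-th power for every `N ≥ 1` is a root of unity,
  i.e. `⋂_N (K^×)^N ⊆ μ(K)` (`DVRFinGenDivisibleUnitsTorsion.lean`).

Proof-only, no definitions. [cite: MochizukiAbsTopIII2015, Rmk 1.5.4 (iv) p.34]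
-/

noncomputable section

open scoped Classical
open Polynomial IsLocalRing

namespace Literature.AnabelianGeometry.AbsoluteAnabelian

open AbsTopIII

universe u

/-- `p` lies in the maximal ideal of `W(𝔽̄_p)`. [cite: MochizukiTopics2003, Def 4.11 p.44] -/
private theorem witt_p_mem_maximalIdeal' (p : ℕ) [Fact p.Prime] :
    ((p : ℕ) : WittVector p (AlgebraicClosure (ZMod p))) ∈
      maximalIdeal (WittVector p (AlgebraicClosure (ZMod p))) :=
  (IsLocalRing.mem_maximalIdeal _).mpr (WittVector.irreducible p).not_isUnit

/-- Every Witt vector over `𝔽̄_p` satisfies a monic integer polynomial modulo `p`.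
[cite: MochizukiTopics2003, Def 4.11 p.44] -/
private theorem witt_exists_monic_aeval_mem' (p : ℕ) [Fact p.Prime]
    (a : WittVector p (AlgebraicClosure (ZMod p))) :
    ∃ f : ℤ[X], f.Monic ∧ aeval a f ∈ maximalIdeal (WittVector p (AlgebraicClosure (ZMod p))) := by
  set c : AlgebraicClosure (ZMod p) := WittVector.constantCoeff a with hc
  have hcint : IsIntegral (ZMod p) c := Algebra.IsIntegral.isIntegral c
  set g : (ZMod p)[X] := minpoly (ZMod p) c with hg
  have hgmonic : g.Monic := minpoly.monic hcint
  have hlifts : g ∈ Polynomial.lifts (Int.castRingHom (ZMod p)) :=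
    Polynomial.mem_lifts_of_surjective (f := Int.castRingHom (ZMod p))
      (fun y => ZMod.intCast_surjective y) g
  obtain ⟨f, hfg, -, hfmonic⟩ := Polynomial.lifts_and_natDegree_eq_and_monic hlifts hgmonic
  refine ⟨f, hfmonic, ?_⟩
  have hmax : maximalIdeal (WittVector p (AlgebraicClosure (ZMod p))) =
      Ideal.span {(p : WittVector p (AlgebraicClosure (ZMod p)))} :=
    (IsDiscreteValuationRing.irreducible_iff_uniformizer _).mp (WittVector.irreducible p)
  have hcomm : WittVector.constantCoeff (aeval a f) = aeval c f := by
    rw [hc]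
    exact (Polynomial.aeval_algHom_apply (WittVector.constantCoeff.toIntAlgHom) a f).symm
  rw [hmax, ← WittVector.ker_constantCoeff, RingHom.mem_ker, hcomm]
  have h0 : aeval c g = 0 := minpoly.aeval (ZMod p) c
  rw [← hfg] at h0
  rw [Polynomial.aeval_def, Polynomial.eval₂_map,
    show (algebraMap (ZMod p) (AlgebraicClosure (ZMod p))).comp (Int.castRingHom (ZMod p)) =
        algebraMap ℤ (AlgebraicClosure (ZMod p)) from Subsingleton.elim _ _] at h0
  exact h0

/-- **A `p`-adic order on a generalized sub-`p`-adic field**: there is a homomorphism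
`w : K^× → ℤ` with `w(p) ≠ 0` (pull back the Gauss `p`-order ∘ norm of a finitely generated
extension of `Frac W(𝔽̄_p)` containing `K`). [cite: MochizukiTopics2003, Def 4.11 p.44] -/
theorem AbsTopIII.IsGeneralizedSubpadicFor.exists_unitsHom_apply_natCast_ne_one {K : Type u} [Field K]
    {p : ℕ} [Fact p.Prime] (hK : IsGeneralizedSubpadicFor K p) :
    ∃ w : Kˣ →* Multiplicative ℤ, ∀ h0 : ((p : ℕ) : K) ≠ 0, w (Units.mk0 ((p : ℕ) : K) h0) ≠ 1 := by
  have hprime : (p : ℕ).Prime := Fact.out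
  obtain ⟨L, _, _, hLfg, ⟨ι⟩⟩ := hK.exists_embedding
  haveI : Algebra.EssFiniteType (FractionRing (WittVector p (AlgebraicClosure (ZMod p)))) L :=
    IntermediateField.fg_top_iff.mp hLfg
  haveI : CharZero (FractionRing (WittVector p (AlgebraicClosure (ZMod p)))) := by
    obtain ⟨φ₀⟩ := AbsTopIII.nonempty_padic_ringHom_fracWitt p
    exact charZero_of_injective_ringHom φ₀.injective
  haveI : CharZero L := charZero_of_injective_ringHom
    (algebraMap (FractionRing (WittVector p (AlgebraicClosure (ZMod p)))) L).injective
  obtain ⟨w, hw⟩ := exists_unitsHom_of_essFiniteType_of_irreducible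
    (WittVector p (AlgebraicClosure (ZMod p)))
    (FractionRing (WittVector p (AlgebraicClosure (ZMod p)))) (WittVector.irreducible p) L
  refine ⟨w.comp (Units.map (ι : K →* L)), fun h0 => ?_⟩
  have hpL : algebraMap (FractionRing (WittVector p (AlgebraicClosure (ZMod p)))) L
      (algebraMap (WittVector p (AlgebraicClosure (ZMod p))) _ (p : ℕ)) = (p : L) := by
    rw [map_natCast, map_natCast]
  have hpL0 : (p : L) ≠ 0 := Nat.cast_ne_zero.mpr hprime.ne_zero
  have hw' := hw (by rw [hpL]; exact hpL0)
  rw [MonoidHom.comp_apply]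
  convert hw' using 2
  apply Units.ext
  simp

/-- **Infinitely divisible elements of a generalized sub-`p`-adic field are roots of unity**
(the positive complement of [AbsTopIII] Rmk 1.5.4 (iv): such fields fail toral Kummer-faithfulness
only through torsion): if `x ∈ K^×` is an `N`-th power for every `N ≥ 1`, then `x` has finite order.
[cite: MochizukiAbsTopIII2015, Rmk 1.5.4 (iv) p.34] -/
theorem AbsTopIII.IsGeneralizedSubpadicFor.isOfFinOrder_of_forall_exists_pow_eq {K : Type u} [Field K]
    {p : ℕ} [Fact p.Prime] (hK : IsGeneralizedSubpadicFor K p) (x : Kˣ)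
    (hx : ∀ N : ℕ, 0 < N → ∃ y : Kˣ, y ^ N = x) : IsOfFinOrder x := by
  obtain ⟨L, _, _, hLfg, ⟨ι⟩⟩ := hK.exists_embedding
  haveI : Algebra.EssFiniteType (FractionRing (WittVector p (AlgebraicClosure (ZMod p)))) L :=
    IntermediateField.fg_top_iff.mp hLfg
  haveI : CharZero (FractionRing (WittVector p (AlgebraicClosure (ZMod p)))) := by
    obtain ⟨φ₀⟩ := AbsTopIII.nonempty_padic_ringHom_fracWitt p
    exact charZero_of_injective_ringHom φ₀.injective
  set xL : Lˣ := Units.map (ι : K →* L) x with hxL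
  have hxLdiv : ∀ N : ℕ, 0 < N → ∃ y : Lˣ, y ^ N = xL := by
    intro N hN
    obtain ⟨b, hb⟩ := hx N hN
    exact ⟨Units.map (ι : K →* L) b, by rw [← map_pow, hb]⟩
  have hfin : IsOfFinOrder xL :=
    isOfFinOrder_of_forall_exists_pow_eq_of_essFiniteType
      (WittVector p (AlgebraicClosure (ZMod p)))
      (FractionRing (WittVector p (AlgebraicClosure (ZMod p))))
      (witt_p_mem_maximalIdeal' p) (witt_exists_monic_aeval_mem' p) L xL hxLdiv
  obtain ⟨m, hm, hum⟩ := hfin.exists_pow_eq_one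
  refine isOfFinOrder_iff_pow_eq_one.mpr ⟨m, hm, ?_⟩
  have hinj : Function.Injective (Units.map (ι : K →* L)) := by
    intro a b hab
    exact Units.ext (ι.injective (congrArg Units.val hab))
  apply hinj
  rw [map_pow, map_one]
  exact hum

/-- The same over the `IsSubpadicFor` hypothesis ([Tpcs] Rmk following Def 4.11: sub-`p`-adic
fields are generalized sub-`p`-adic). [cite: MochizukiAbsTopIII2015, Rmk 1.5.4 (iv) p.34] -/
theorem AbsTopIII.IsSubpadicFor.isOfFinOrder_of_forall_exists_pow_eq {K : Type u} [Field K]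
    {p : ℕ} [Fact p.Prime] (hK : IsSubpadicFor K p) (x : Kˣ)
    (hx : ∀ N : ℕ, 0 < N → ∃ y : Kˣ, y ^ N = x) : IsOfFinOrder x :=
  hK.isGeneralizedSubpadicFor.isOfFinOrder_of_forall_exists_pow_eq x hx

end Literature.AnabelianGeometry.AbsoluteAnabelian
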